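import Summits.CriticalPhenomena.Ising3DConformalLimit.Theses.OctaveForgetting
import Summits.CriticalPhenomena.Ising3DConformalLimit.Theorems.OctaveForgettingSphereVarianceUpperBoundCounting
import Literature.Probability.LatticeModels.HighDimTrivialityUniformProofs
import Literature.Probability.LatticeModels.HighDimTrivialityMoments
import Literature.Probability.LatticeModels.CriticalGibbsUniqueness
import Literature.Probability.LatticeModels.FreeStateGibbs
import Literature.Probability.LatticeModels.CriticalTwoPointBounds
import HarnessLib

/-!
# `OctaveForgetting.SphereVarianceUpperBound` (item stmt-CriticalPhenomena-8106), proved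

THEOREM-ONLY file (no definitions, no named facts). The support item (card (L2), variance half:
the infrared calibration) of route `OctaveForgetting`: there is `C` with
`Var_μ(∑_{y ∈ S_R} σ_y) ≤ C R³` for all `R ≥ 1` and every `μ ∈ 𝒢(β_c(3), 0)`, where
`S_R = {y ∈ Λ_R : R² ≤ |y|² < (R+1)²}` is the lattice sphere of the route file.

Proof. `Var ≤ ⟨(∑ σ_y)²⟩ = ∑_{a,b ∈ S_R} ⟨σ_aσ_b⟩_μ` (`sqMoment_eq_sum`). At `β_c(3)` the Gibbs
measure is unique (`hasUniqueGibbsMeasure_criticalBeta_holds`, Aizenman–Duminil-Copin–Sidoravicius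
2015), so `μ` is the translation-invariant free state and `⟨σ_aσ_b⟩_μ = ⟨σ₀σ_{b-a}⟩^f_{β_c}`
(`isingGibbsMeasure_twoPoint_of_facts` fed with the tree's uniqueness theorems and
`exists_freeMeasure_holds`); the `x`-space infrared bound
`⟨σ₀σ_x⟩^f_{β_c} ≤ C₀ ‖x‖_∞⁻¹` (`twoPointFree_criticalBeta_upper_holds`, Fröhlich–Simon–Spencer
1976 / Duminil-Copin 2019 Thm. 4.8) gives `⟨σ_aσ_b⟩_μ ≤ C₁ / max(1, ‖b-a‖_∞)`; and the lattice-point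
counting on thin shells (`sum_sum_sphere_le` of the `…Counting` helper file: cap counts
`#{b ∈ S_R : ‖b-a‖_∞ ≤ k} ≤ 12(2k+1)²`, `|S_R| ≤ 108 R²`, Abel summation) bounds the double sum by
`46656 C₁ R³`.

References: J. Fröhlich, B. Simon, T. Spencer, CMP 50 (1976) 79; M. Aizenman, H. Duminil-Copin,
V. Sidoravicius, CMP 334 (2015) 719; H. Duminil-Copin, *Lectures on the Ising and Potts models on
the hypercubic lattice* (2019), Thm. 4.8.
-/

noncomputable section

namespace Summit.CriticalPhenomena.Ising3DConformalLimit.Theorems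

open MeasureTheory Literature.Probability.LatticeModels Finset
open Summit.CriticalPhenomena.Ising3DConformalLimit.Theses

/-- **Two-point function of a critical Gibbs state on `ℤ³`.** Every `μ ∈ 𝒢(β_c(3), 0)` is a
probability measure with `⟨σ_xσ_y⟩_μ = ⟨σ₀σ_{y-x}⟩^f_{β_c}`: uniqueness at `β_c`
(`hasUniqueGibbsMeasure_criticalBeta_holds`) identifies `μ` with the translation-invariant free
state (`exists_freeMeasure_holds`); assembled by `isingGibbsMeasure_twoPoint_of_facts`. [folklore] -/
theorem critical_gibbs_twoPoint_eq_twoPointFree {μ : Measure (SpinConfig (Site 3))}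
    (hμ : μ ∈ isingGibbsMeasures 3 (criticalBeta 3) 0) :
    IsProbabilityMeasure μ ∧
      ∀ x y : Site 3, ∫ σ, spinAt x σ * spinAt y σ ∂μ = twoPointFree 3 (criticalBeta 3) (y - x) :=
  isingGibbsMeasure_twoPoint_of_facts
    (fun {_ _} => hasUniqueGibbsMeasure_of_lt_criticalBeta_holds)
    (fun {_} => hasUniqueGibbsMeasure_criticalBeta_holds)
    (fun d {_} => exists_freeMeasure_holds d 0) le_rfl (criticalBeta_nonneg 3) le_rfl hμ

/-- **The `x`-space infrared bound on `ℤ³` in `1/max(1,‖x‖_∞)` form.** There is `C₁ ≥ 0` with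
`⟨σ₀σ_v⟩^f_{β_c(3)} ≤ C₁ / max(1, ‖v‖_∞)` for every `v ∈ ℤ³` (`v = 0`: `⟨σ₀σ₀⟩ = 1 ≤ C₁`;
`v ≠ 0`: `twoPointFree_criticalBeta_upper_holds` with `‖v‖^{-(3-2)} = ‖v‖_∞⁻¹`). [folklore] -/
theorem twoPointFree_criticalBeta_three_le_div_max :
    ∃ C₁ : ℝ, 0 ≤ C₁ ∧ ∀ v : Site 3,
      twoPointFree 3 (criticalBeta 3) v ≤ C₁ / max 1 (Site.supNorm v : ℝ) := by
  obtain ⟨C, hC⟩ := twoPointFree_criticalBeta_upper_holds (d := 3) le_rfl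
  refine ⟨max 1 C, le_trans zero_le_one (le_max_left _ _), fun v => ?_⟩
  by_cases hv : v = 0
  · subst hv
    have h0 : Site.supNorm (0 : Site 3) = 0 := Site.supNorm_eq_zero_iff.2 rfl
    rw [twoPointFree_zero, h0, Nat.cast_zero, max_eq_left (zero_le_one' ℝ), div_one]
    exact le_max_left _ _
  · have h := hC v hv
    have hk : 1 ≤ Site.supNorm v :=
      Nat.one_le_iff_ne_zero.2 fun h0 => hv (Site.supNorm_eq_zero_iff.1 h0)
    have hk' : (1 : ℝ) ≤ (Site.supNorm v : ℝ) := by exact_mod_cast hk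
    have hkpos : (0 : ℝ) < (Site.supNorm v : ℝ) := by linarith
    have he : (-(((3 : ℕ) : ℝ) - 2)) = (-1 : ℝ) := by norm_num
    rw [Site.norm_eq_supNorm, he, Real.rpow_neg_one] at h
    rw [max_eq_right hk']
    calc twoPointFree 3 (criticalBeta 3) v ≤ C * ((Site.supNorm v : ℝ))⁻¹ := h
      _ ≤ max 1 C * ((Site.supNorm v : ℝ))⁻¹ :=
          mul_le_mul_of_nonneg_right (le_max_right _ _) (inv_nonneg.2 hkpos.le)
      _ = max 1 C / (Site.supNorm v : ℝ) := by rw [div_eq_mul_inv]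

/-- **`SphereVarianceUpperBound` (item stmt-CriticalPhenomena-8106 of route `OctaveForgetting`),
proved**: there is `C` with `Var_μ(∑_{y ∈ S_R} σ_y) ≤ C R³` for all `R ≥ 1` and all
`μ ∈ 𝒢(β_c(3), 0)`, `S_R = {y ∈ Λ_R : R² ≤ |y|² < (R+1)²}`. Variance `≤` second moment
`= ∑_{a,b ∈ S_R} ⟨σ_aσ_b⟩_μ` (`sqMoment_eq_sum`); `⟨σ_aσ_b⟩_μ = ⟨σ₀σ_{b-a}⟩^f_{β_c} ≤
C₁ / max(1,‖b-a‖_∞)` (uniqueness at `β_c` + the `x`-space infrared bound); thin-shell lattice-point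
counting (`sum_sum_sphere_le`) gives `≤ 46656 C₁ R³`. Settles item stmt-CriticalPhenomena-8106
(exact signature). [folklore] -/
theorem SphereVarianceUpperBound_proof : OctaveForgetting.SphereVarianceUpperBound := by
  obtain ⟨C₁, hC₁, hG⟩ := twoPointFree_criticalBeta_three_le_div_max
  refine ⟨46656 * C₁, fun R hR μ hμ => ?_⟩
  obtain ⟨hprob, htp⟩ := critical_gibbs_twoPoint_eq_twoPointFree hμ
  set S : Finset (Site 3) := (box 3 R).filter (fun y => (R : ℤ) ^ 2 ≤ ∑ i, y i ^ 2 ∧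
    ∑ i, y i ^ 2 < ((R : ℤ) + 1) ^ 2) with hSdef
  have hS : ∀ y ∈ S, (R : ℤ) ^ 2 ≤ ∑ i, y i ^ 2 ∧ ∑ i, y i ^ 2 < ((R : ℤ) + 1) ^ 2 :=
    fun y hy => (mem_filter.1 hy).2
  have hbox : ∀ y ∈ S, Site.supNorm y ≤ R :=
    fun y hy => mem_box_iff_supNorm_le.1 (mem_filter.1 hy).1
  have h2 : ∫ σ, (∑ y ∈ S, spinAt y σ) ^ 2 ∂μ =
      ∑ a ∈ S, ∑ b ∈ S, ∫ σ, spinAt a σ * spinAt b σ ∂μ := by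
    have h := sqMoment_eq_sum μ S (fun _ => 1)
    simpa [sqMoment, spinSum] using h
  calc ∫ σ, (∑ y ∈ S, spinAt y σ) ^ 2 ∂μ - (∫ σ, (∑ y ∈ S, spinAt y σ) ∂μ) ^ 2
      ≤ ∫ σ, (∑ y ∈ S, spinAt y σ) ^ 2 ∂μ := sub_le_self _ (sq_nonneg _)
    _ = ∑ a ∈ S, ∑ b ∈ S, ∫ σ, spinAt a σ * spinAt b σ ∂μ := h2
    _ ≤ 46656 * C₁ * (R : ℝ) ^ 3 :=
        sum_sum_sphere_le R hR S hS hbox C₁ hC₁ (fun a b => ∫ σ, spinAt a σ * spinAt b σ ∂μ)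
          fun a b => by rw [htp a b]; exact hG (b - a)

end Summit.CriticalPhenomena.Ising3DConformalLimit.Theorems
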